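import Summits.BirchSwinnertonDyer.BirchSwinnertonDyer.Theorems.KimAtThreeDeepLowerOffStratumAdditiveDefectPortTwoExpEnd
import Summits.BirchSwinnertonDyer.BirchSwinnertonDyer.Theorems.KimAtThreeKolyvaginMinimalCertificate
import Summits.BirchSwinnertonDyer.BirchSwinnertonDyer.Theorems.KimAtThreeTwoExponentTower
import Summits.BirchSwinnertonDyer.Rank1Residual.GaloisImage.LocalThreeTorsionCount
import HarnessLib

/-!
# Crux `DeepLowerAtThreeOffKatoStratum` (item 19679), stub `stub_additiveDefect`, file 2/2: the LOWER inequality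
# on EVERY additive-defect row (every `t = v₃ #E(ℚ₃)[3]`, every defect exponent `e`) and the registered stub
# VERBATIM, GRANTED the two-exponent port PORT₂ — route W2 `KimAtThreeKolyvagin`, cell `bsd-addord`, seat
# `bsd-addord-w2-acc3` (PROGRAMME PART 1b row (3))

HONEST FRAMING. TOOL theorems only (no definition, no named fact, no `sorry`); nothing asserted, nothing booked,
no mark moved; crux 19679 stays OPEN (owner = the w2-c2 successor, who assembles via
`Cruxes.DeepLowerAtThreeOffKatoStratum.Birth.DeepLowerAtThreeOffKatoStratum_of`).  Sequel of
`KimAtThreeDeepLowerOffStratumAdditiveDefectPortTwoExpEnd` (§1–§2 there; module docstring for the road and its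
PRICE: S24-DEEP `hS24d`/`hS24d₂`, GZK, Poitou–Tate, and acc6's PORT₂
`KimAtThreeKolyvaginDefs.KatoKuriharaPortThreeAtWith₂TwoExp`, FLAG `K22-Thm3.13-PORT@3`).

* §3 `deepLower_datum_of_plusSymbolEndShapeBound` — kim3's `deepLower_datum_of_endShapeBound` with the END bound
  read on `[0]⁺_{D.f}` (`kuriharaDivIndex_one_eq`): no period transfer, no Manin binder.
* §4 `deepLower_datum_of_deepPortsTwoExp` — the conclusion of 19679 for `(W, D.f)` on an ADDITIVE row `(t, e)` at
  `N = N_E`, GRANTED the four names + PORT₂ (`K = 2t + 1`).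
* §5 `finite_threeTorsion_padic`, `exists_natCard_threeTorsion_eq_three_pow` — `#E(ℚ₃)[3] = 3^t` for SOME `t`
  (the `3`-torsion of `E(ℚ₃)` is finite: `x`-coordinates are roots of `Ψ₃ ≠ 0`, Mathlib `Ψ₃_ne_zero`; two `y`
  per `x`), so the row binder `ht` of every W2 END theorem exists on every row.
* §4′ `deepLower_datum_of_portTwoExp_torsionFree` — on the `t = 0` defect rows (`3 ∣ c₃ ∨ 3 ∣ c_D`, `#E(ℚ₃)[3] = 1`)
  the same conclusion from the PRINTED [S24] Thm. 4.4 (1)(2) (`hS24`/`hS24₂`, PUB) in place of S24-DEEP: acc6's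
  all-levels `KimAtThreeTwoExponentTower.kuriharaPartial_zero_le_sha_add_partialInfty_of_portTwoExp` + the comparison
  `kuriharaPartialInfty_le_kuriharaPartialDeepInfty` (all-levels `≤` deep).
* §6 **`stubAdditiveDefect_of_portTwoExp`** — TYPE = the registered `stub_additiveDefect` of the BC3 birth
  skeleton (`planner/splitW2L/bc/DeepLowerAtThreeOffKatoStratum_birth.lean`, sha256 e575d03075635394) VERBATIM,
  GRANTED `hS24d hS24d₂ hGZK hPT` + `hPort₂` = PORT₂-SHARED on the additive-defect rows (crux 19560's
  `KatoKuriharaPortThreeShared` shape with the defect disjunction in place of `3 ∤ c₃ ∧ t = 0 ∧ 3 ∤ c_P`, `∀ t`,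
  `∃ e`).  The skeleton's `DeepLowerAtThreeOffKatoStratum_of (h₁ := stub_nonAdditive) (h₂ := §6 …)` type-checks
  (seat folder `work/check_composition.lean`).
What is NOT here: the non-additive rows (acc2 / w2-c2's level-lowering road); any discharge of PORT₂ (★ PK-6₂'s
road with the IV/IV* lattice lemma, acc6's docstring); a stub-level theorem mixing printed [S24] on `t = 0` rows with
S24-DEEP on `t ≥ 1` rows (row-level: §4′ / §4).
References: [Kim2025RefinedTNC] Thm 1.1; [Kim2022StructureSelmer] Thm. 1.9 (6), Thm. 3.13, §1.5.1;
[Sakamoto2024] Thm. 4.4; [MazurRubin2004] Thm. 5.2.12, Cor. 5.2.13; [MilneADT2006] I Thm. 4.10; [SilvermanAEC2009]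
Ex. 3.7; cell memo `run/shared/lean/pub/bsd-addord/kim3/KIM3-PROOF.md` §14, §16.
-/

set_option autoImplicit false
-- the Theorems namespace of a single-conjunct summit repeats the summit name by design (D-0017)
set_option linter.dupNamespace false

noncomputable section

open scoped Classical NumberField ContRepresentation
open Function Field NumberField IsDedekindDomain IsDedekindDomain.HeightOneSpectrum WeierstrassCurve
  CongruenceSubgroup
  Literature.NumberTheory.EllipticCurves Literature.NumberTheory.EllipticCurves.ModularForms
  Literature.NumberTheory.EllipticCurves.Rank1Residual
  Literature.NumberTheory.GaloisRepresentations
  Literature.NumberTheory.GaloisRepresentations.DiscreteGaloisModule Literature.NumberTheory.GaloisCohomology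
  Rat.HeightOneSpectrum
  Summit.BirchSwinnertonDyer.Rank1Residual.GaloisImage
  Summit.BirchSwinnertonDyer.Rank1Residual.GaloisImage.Assembly
  Summit.BirchSwinnertonDyer.Rank1Residual.GaloisImage.S24Deep
  Summit.BirchSwinnertonDyer.Rank1Residual.X4
  Summit.BirchSwinnertonDyer.BirchSwinnertonDyer.Theorems.KimAtThreeKolyvaginUnitLevelOneRungs
  Summit.BirchSwinnertonDyer.BirchSwinnertonDyer.Theorems.KimAtThreeKolyvaginCertificateDictionary
  Summit.BirchSwinnertonDyer.BirchSwinnertonDyer.Theorems.KimAtThreeKolyvaginMinimalCertificate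
  Summit.BirchSwinnertonDyer.BirchSwinnertonDyer.Theorems.KimAtThreeDeepLowerKatoStratumOfFacts
  Summit.BirchSwinnertonDyer.BirchSwinnertonDyer.Theorems.KimAtThreeDeepLowerDeepPortWith
  Summit.BirchSwinnertonDyer.BirchSwinnertonDyer.Theorems.KimAtThreeKolyvaginDefs
  Summit.BirchSwinnertonDyer.BirchSwinnertonDyer.Theorems.KimAtThreeTwoExponentEnd
  Summit.BirchSwinnertonDyer.BirchSwinnertonDyer.Theorems.KimAtThreeTwoExponentTower
  Summit.BirchSwinnertonDyer.BirchSwinnertonDyer.Theorems.KimAtThreeDeepLowerOffStratumAdditiveDefectPortTwoExpEnd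

namespace Summit.BirchSwinnertonDyer.BirchSwinnertonDyer.Theorems.KimAtThreeDeepLowerOffStratumAdditiveDefectPortTwoExp

/-! ### §3 The `∂`-currency conclusion from an END-shape bound on `[0]⁺_f` (no period transfer) -/

/-- **Crux 19679's conclusion on a parametrised row from a bound in END-THEOREM SHAPE read on `[0]⁺_f`.**
For a tower row with a parametrisation datum `D` and `ord(δ̃) = 0`, suppose `hEnd`: for every modulus `1 ≤ j'`,
every depth `L` with `K + j' ≤ L + 1` and every cyclic level `n ∈ 𝒩_L(E,3)`, ONE system `ψ` with
`kuriharaNumber D.f (3^{j'}) n ψ ≠ 0` whose proper divisors `1 < d < n` have `kuriharaNumber D.f (3^{j'}) d ψ = 0`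
gives `ord₃ [0]⁺_{D.f} ≤ ord₃ #Ш(E/ℚ)(3) + (j' − 1)` (the conclusion block of acc6's two-exponent END theorems,
`[0]⁺_f`-currency).  THEN `∂^{(∞)}_deep(δ̃) = d ∈ ℕ` and `∂⁽⁰⁾(δ̃) ≤ ord₃ #Ш(E/ℚ)(3) + d` for `(W, D.f)`.
kim3's `KimAtThreeKolyvaginMinimalCertificate.deepLower_datum_of_endShapeBound` with the conversion step
`kuriharaPartial_zero` + `kuriharaDivIndex_one_eq` in place of the period transfer (credit seat kim3; adapted).
Nothing is asserted: `hEnd` is a hypothesis. [cite: Kim2022StructureSelmer, Thm. 1.9 (6), Thm. 3.13, §1.5.1 (PDF p. 7)]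
[cite: Kim2025RefinedTNC, Thm 1.1] [cite: MazurRubin2004, Thm. 5.2.12, Cor. 5.2.13] -/
theorem deepLower_datum_of_plusSymbolEndShapeBound
    (W : WeierstrassCurve ℚ) [W.IsElliptic] [W.IsGloballyMinimal]
    (htower : ∀ n : ℕ, W.HasSurjectiveModNGaloisRep (3 ^ n : ℕ))
    {N : ℕ} [NeZero N] (D : ModularParametrizationData W N)
    (hord : kuriharaVanishingOrder W 3 D.f = 0) (K : ℕ)
    (hEnd : ∀ (j' L n : ℕ), 1 ≤ j' → K + j' ≤ L + 1 → IsCyclicKolyvaginLevel W 3 n →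
      ∀ hL : Kato.IsKolyvaginProduct W 3 L n,
      ∀ ψ : (ℓ : ℕ) → (ZMod ℓ)ˣ →* Multiplicative (ZMod (3 ^ j')),
        (∀ ℓ ∈ n.primeFactors, Function.Surjective (ψ ℓ)) →
        (haveI : NeZero n := ⟨hL.ne_zero⟩; kuriharaNumber D.f (3 ^ j') n ψ ≠ 0) →
        (∀ d : ℕ, d ∣ n → 1 < d → d < n → ∀ [NeZero d], kuriharaNumber D.f (3 ^ j') d ψ = 0) →
        padicValRat 3 (ratPlusSymbol D.f 0) ≤
          (padicValNat 3 (Nat.card (AddCommGroup.primaryComponent W.sha 3)) : ℤ) + ((j' - 1 : ℕ) : ℤ)) :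
    ∃ d : ℕ, kuriharaPartialDeepInfty W 3 D.f = d ∧
      kuriharaPartial W 3 D.f 0 ≤
        ((padicValNat 3 (Nat.card (AddCommGroup.primaryComponent W.sha 3)) + d : ℕ) : ℕ∞) := by
  haveI : Fact (Nat.Prime 3) := ⟨Nat.prime_three⟩
  haveI : NeZero ((3 : ℕ) : ℚ) := ⟨by norm_num⟩
  set s := padicValNat 3 (Nat.card (AddCommGroup.primaryComponent W.sha 3)) with hs
  have hirr : W.HasIrreducibleModPGaloisRep 3 :=
    hasIrreducibleModPGaloisRep_of_hasSurjectiveModNGaloisRep W 3 (by simpa using htower 1)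
  have h0 : ratPlusSymbol D.f 0 ≠ 0 :=
    ratPlusSymbol_zero_ne_zero_of_kuriharaVanishingOrder_eq_zero W 3 D.f hord
  -- `[0]⁺_{D.f}` is `3`-integral, so `∂⁽⁰⁾ = ord₃ [0]⁺_{D.f}`
  have hint : ¬ 3 ∣ (ratPlusSymbol D.f 0).den :=
    not_dvd_den_of_norm_ratCast_le_one
      (D.isNewformOf.norm_ratPlusSymbol_le_one (x := 0) (by norm_num) hirr (by simp))
  have hpart : kuriharaPartial W 3 D.f 0 = ((padicValRat 3 (ratPlusSymbol D.f 0)).toNat : ℕ∞) := by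
    rw [kuriharaPartial_zero, kuriharaDivIndex_one_eq W 3 D.f hint h0]
  have hfin0 : kuriharaPartial W 3 D.f 0 < ⊤ := by
    rw [hpart]; exact ENat.coe_lt_top _
  obtain ⟨a, ha⟩ : ∃ a : ℕ, kuriharaPartial W 3 D.f 0 = a := ⟨_, hpart⟩
  -- the uniform bound at every certificate, from the END-shape bound at minimal certificates
  have hunif : ∀ j k n : ℕ, K + j ≤ k → IsCyclicKolyvaginLevel W 3 n →
      Kato.IsKolyvaginProduct W 3 k n → ¬ KuriharaDivisibleAt W 3 D.f n (j + 1) →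
        kuriharaPartial W 3 D.f 0 ≤ ((s + j : ℕ) : ℕ∞) := by
    refine uniformCertificateBound_of_minimal W 3 D.f s K fun j k c hk hc hkc _ hcert hmin => ?_
    obtain ⟨k', hk'1, hk'j, hk', ψ, hψ, hne, hv⟩ :=
      exists_endShape_of_minimal_certificate W 3 D.f hcert hmin
    have hle := hEnd k' k c hk'1 (by omega) hc hkc ψ hψ hne hv
    have hle' : padicValRat 3 (ratPlusSymbol D.f 0) ≤ ((s + j : ℕ) : ℤ) := by
      have : ((k' - 1 : ℕ) : ℤ) ≤ (j : ℤ) := by exact_mod_cast (show k' - 1 ≤ j by omega)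
      push_cast at hle ⊢
      linarith
    rw [hpart]
    exact_mod_cast Int.toNat_le.mpr hle'
  refine (deepLower_conclusion_iff_eventuallyDivisible W 3 D.f ha s).mpr ⟨?_, fun i j hj => ?_⟩
  · exact lt_of_le_of_lt (kuriharaPartialDeepInfty_le_kuriharaPartial_zero W 3 D.f) hfin0
  · refine ⟨K + j, fun n hn hkn _ => ?_⟩
    by_contra hcert
    have h' := hunif j (K + j) n le_rfl hn hkn hcert
    rw [ha] at h'
    have h'' : a ≤ s + j := by exact_mod_cast h'
    omega

/-! ### §4 The conclusion of item 19679 on a row `(t, e)`, GRANTED PORT₂ -/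

/-- **Crux `DeepLowerAtThreeOffStratum`'s conclusion on an ADDITIVE row, every `t`, every defect exponent
`e`, GRANTED the two-exponent port.** For `W/ℚ` globally minimal, ADDITIVE at `3` (no hypothesis on `c₃`), the
`3`-adic tower onto, `#E(ℚ₃)[3] = 3^t`, a parametrisation datum `D` at the conductor (`N = N_E`; no Manin /
period binder), generators `η`, the port `KatoKuriharaPortThreeAtWith₂TwoExp W t e v₃ η D`, `ord(δ̃) = 0`;
GRANTED `hS24d`/`hS24d₂`, `hGZK`, `hPT`: `∂^{(∞)}_deep(δ̃) = d ∈ ℕ` and `∂⁽⁰⁾(δ̃) ≤ ord₃ #Ш(E/ℚ)(3) + d` for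
`(W, D.f)` — §3 at `K = 2t + 1` over §2 at depth `k = L − t − 1` (w2-c2's `deepLower_datum_of_deepPortsWith₂`
shape). Nothing asserted. [cite: Kim2025RefinedTNC, Thm 1.1] [cite: Kim2022StructureSelmer, Thm. 1.9 (6), Thm. 3.13]
[cite: Sakamoto2024, Thm. 4.4 (p. 926)] [cite: MazurRubin2004, Thm. 5.2.12, Cor. 5.2.13] -/
theorem deepLower_datum_of_deepPortsTwoExp
    (hS24d : S24Deep.kolyvaginSystems_freeRankOne_zmod_three_pow_deep)
    (hS24d₂ : S24Deep.kolyvaginSystems_idealOfBasis_eq_fittingIdeal_zmod_three_pow_deep)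
    (hGZK : rank_eq_analyticRank_of_analyticRank_le_one)
    (hPT : poitouTate_selmerStructure_duality ℚ)
    (W : WeierstrassCurve ℚ) [W.IsElliptic] [W.IsGloballyMinimal] (t e : ℕ)
    (hadd : haveI : Fact (Nat.Prime 3) := ⟨Nat.prime_three⟩; Addv W 3)
    (htower : ∀ m : ℕ, W.HasSurjectiveModNGaloisRep (3 ^ m : ℕ))
    (ht : Nat.card {Q : (W.baseChange ℚ_[3]).toAffine.Point // (3 : ℕ) • Q = 0} = 3 ^ t)
    {N : ℕ} [NeZero N] (hNc : N = W.conductorNorm ℤ) (D : ModularParametrizationData W N)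
    (v₃ : HeightOneSpectrum (𝓞 ℚ)) (hv₃ : ((3 : ℕ) : 𝓞 ℚ) ∈ v₃.asIdeal)
    (η : (q : HeightOneSpectrum (𝓞 ℚ)) → (ZMod (Ideal.absNorm q.asIdeal))ˣ)
    (hη : ∀ q : HeightOneSpectrum (𝓞 ℚ), Subgroup.zpowers (η q) = ⊤)
    (hPort : KatoKuriharaPortThreeAtWith₂TwoExp W t e v₃ η D)
    (hord : kuriharaVanishingOrder W 3 D.f = 0) :
    ∃ d : ℕ, kuriharaPartialDeepInfty W 3 D.f = d ∧
      kuriharaPartial W 3 D.f 0 ≤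
        ((padicValNat 3 (Nat.card (AddCommGroup.primaryComponent W.sha 3)) + d : ℕ) : ℕ∞) := by
  haveI : Fact (Nat.Prime 3) := ⟨Nat.prime_three⟩
  have h0 : ratPlusSymbol D.f 0 ≠ 0 :=
    ratPlusSymbol_zero_ne_zero_of_kuriharaVanishingOrder_eq_zero W 3 D.f hord
  refine deepLower_datum_of_plusSymbolEndShapeBound W htower D hord (2 * t + 1) ?_
  intro j' L n hj' hKL hcyc hLn ψ hψ hne hv
  haveI : NeZero n := ⟨hLn.ne_zero⟩
  have hk : L - t - 1 + t + 1 = L := by omega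
  have hn' : Kato.IsKolyvaginProduct W 3 (L - t - 1 + t + 1) n := by rw [hk]; exact hLn
  exact padicValRat_ratPlusSymbol_le_of_towerSurj_deep_twoExp hS24d hS24d₂ hGZK hPT W t e (L - t - 1)
    hadd htower ht D h0 v₃ hv₃ η hη hPort n hn' (fun ℓ _ hℓ => hcyc.2 ℓ hℓ)
    (fun ℓ hℓ hℓN => (hLn.2 ℓ hℓ).not_dvd_conductorNorm (hNc ▸ hℓN)) (j := j') (by omega) ψ hψ
    hne hv

/-! ### §4′ The `t = 0` defect rows from the PRINTED [S24] Thm. 4.4 (acc6's all-levels inequality) -/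

/-- **Crux 19679's conclusion on an ADDITIVE row with `#E(ℚ₃)[3] = 1`, every defect exponent `e`, GRANTED the
two-exponent port and the PRINTED [S24] Thm. 4.4 (1)(2)** (`hS24`/`hS24₂`, PUB — not the S24-DEEP ports): acc6's
all-levels inequality `∂⁽⁰⁾ ≤ ord₃ #Ш(3) + ∂^{(∞)}` (`kuriharaPartial_zero_le_sha_add_partialInfty_of_portTwoExp`) and
`∂^{(∞)} ≤ ∂^{(∞)}_deep` (`kuriharaPartialInfty_le_kuriharaPartialDeepInfty`); the deep limit is finite in analytic rank
`0`. So on the Kodaira IV/IV* and `3 ∣ c_D` rows with no local `3`-torsion the LOWER stub rests on {[S24] PUB, GZK,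
Poitou–Tate, PORT₂} only. Nothing asserted. [cite: Kim2025RefinedTNC, Thm 1.1 and §8.1.2]
[cite: Kim2022StructureSelmer, Thm. 1.9 (6), §1.5.1] [cite: Sakamoto2024, Thm. 4.4 (p. 926)] [cite: MazurRubin2004, Def. 5.2.11] -/
theorem deepLower_datum_of_portTwoExp_torsionFree
    (hS24 : Sakamoto2024.kolyvaginSystems_freeRankOne_zmod_three_pow)
    (hS24₂ : Sakamoto2024.kolyvaginSystems_idealOfBasis_eq_fittingIdeal_zmod_three_pow)
    (hGZK : rank_eq_analyticRank_of_analyticRank_le_one)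
    (hPT : poitouTate_selmerStructure_duality ℚ)
    (W : WeierstrassCurve ℚ) [W.IsElliptic] [W.IsGloballyMinimal] (e : ℕ)
    (hadd : haveI : Fact (Nat.Prime 3) := ⟨Nat.prime_three⟩; Addv W 3)
    (htower : ∀ m : ℕ, W.HasSurjectiveModNGaloisRep (3 ^ m : ℕ))
    (ht0 : Nat.card {Q : (W.baseChange ℚ_[3]).toAffine.Point // (3 : ℕ) • Q = 0} = 1)
    {N : ℕ} [NeZero N] (hNc : N = W.conductorNorm ℤ) (D : ModularParametrizationData W N)
    (v₃ : HeightOneSpectrum (𝓞 ℚ)) (hv₃ : ((3 : ℕ) : 𝓞 ℚ) ∈ v₃.asIdeal)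
    (η : (q : HeightOneSpectrum (𝓞 ℚ)) → (ZMod (Ideal.absNorm q.asIdeal))ˣ)
    (hη : ∀ q : HeightOneSpectrum (𝓞 ℚ), Subgroup.zpowers (η q) = ⊤)
    (hPort : KatoKuriharaPortThreeAtWith₂TwoExp W 0 e v₃ η D)
    (hord : kuriharaVanishingOrder W 3 D.f = 0) :
    ∃ d : ℕ, kuriharaPartialDeepInfty W 3 D.f = d ∧
      kuriharaPartial W 3 D.f 0 ≤
        ((padicValNat 3 (Nat.card (AddCommGroup.primaryComponent W.sha 3)) + d : ℕ) : ℕ∞) := by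
  haveI : Fact (Nat.Prime 3) := ⟨Nat.prime_three⟩
  obtain ⟨inv, hperf, hsum, -, hcompl⟩ := hPT 3
  obtain ⟨inv', hperf', hsum', hcompl', hinj'⟩ := exists_localInvariants_three_pow_of_poitouTate hPT
  have hall := kuriharaPartial_zero_le_sha_add_partialInfty_of_portTwoExp hS24 hS24₂ hGZK W hadd htower ht0 hNc D
    e inv hperf hsum hcompl inv' hperf' hsum' hcompl' hinj' v₃ hv₃ η hη hPort hord
  obtain ⟨d, hd⟩ := exists_kuriharaPartialDeepInfty_eq_natCast_of_kuriharaVanishingOrder_eq_zero W 3 D.f hord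
  refine ⟨d, hd, hall.trans ?_⟩
  push_cast
  rw [← hd]
  exact add_le_add le_rfl (kuriharaPartialInfty_le_kuriharaPartialDeepInfty W 3 D.f)

/-! ### §5 `#E(ℚ₃)[3]` is a power of `3` -/

/-- **The `3`-torsion of `E(ℚ₃)` is finite** for any Weierstrass equation `E/ℚ₃` with `Δ ≠ 0`: an affine
point `P = (x, y)` has `3P = O` iff `Ψ₃(x) = 0` (`LocalTorsion3.three_nsmul_some_eq_zero_iff_eval_Ψ₃`, Silverman
*AEC* Ex. 3.7), `Ψ₃ ≠ 0` (Mathlib `Ψ₃_ne_zero`, `3 ≠ 0` in `ℚ₃`) has finitely many roots, and each `x` carries at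
most two `y` (`LocalTorsion3.finite_fibre`). [cite: SilvermanAEC2009, Exercise 3.7(f)] -/
theorem finite_threeTorsion_padic (E : WeierstrassCurve ℚ_[3]) [E.IsElliptic] :
    Finite {Q : E.toAffine.Point // (3 : ℕ) • Q = 0} := by
  have h2 : (2 : ℚ_[3]) ≠ 0 := by norm_num
  have h3 : (3 : ℚ_[3]) ≠ 0 := by norm_num
  -- the set of pairs `(x, y)` on the curve with `Ψ₃(x) = 0` is finite
  have hR : Set.Finite {x : ℚ_[3] | E.Ψ₃.IsRoot x} :=
    Polynomial.finite_setOf_isRoot (WeierstrassCurve.Ψ₃_ne_zero (W := E) h3)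
  have hA : Set.Finite {xy : ℚ_[3] × ℚ_[3] | E.toAffine.Equation xy.1 xy.2 ∧ E.Ψ₃.eval xy.1 = 0} := by
    refine (hR.biUnion (t := fun x => {xy : ℚ_[3] × ℚ_[3] | xy.1 = x ∧ E.toAffine.Equation x xy.2})
      fun x _ => ?_).subset ?_
    · haveI := LocalTorsion3.finite_fibre E h2 x
      have hx : {xy : ℚ_[3] × ℚ_[3] | xy.1 = x ∧ E.toAffine.Equation x xy.2} =
          Set.range (fun y : {y : ℚ_[3] // E.toAffine.Equation x y} => (x, y.1)) := by
        ext ⟨a, b⟩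
        constructor
        · rintro ⟨rfl, hb⟩
          exact ⟨⟨b, hb⟩, rfl⟩
        · rintro ⟨⟨y, hy⟩, hxy⟩
          simp only [Prod.mk.injEq] at hxy
          obtain ⟨rfl, rfl⟩ := hxy
          exact ⟨rfl, hy⟩
      rw [hx]
      exact Set.finite_range _
    · rintro ⟨x, y⟩ ⟨heq, hΨ⟩
      exact Set.mem_biUnion (show x ∈ {x : ℚ_[3] | E.Ψ₃.IsRoot x} from hΨ) ⟨rfl, heq⟩
  haveI := hA.to_subtype
  -- the affine `3`-torsion points inject into that set
  have hS : Finite {xy : ℚ_[3] × ℚ_[3] // ∃ h : E.toAffine.Nonsingular xy.1 xy.2,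
      (3 : ℕ) • (Affine.Point.some xy.1 xy.2 h : E.toAffine.Point) = 0} := by
    refine Finite.of_injective (fun s => (⟨s.1, ?_⟩ :
      {xy : ℚ_[3] × ℚ_[3] | E.toAffine.Equation xy.1 xy.2 ∧ E.Ψ₃.eval xy.1 = 0})) ?_
    · obtain ⟨h, h3P⟩ := s.2
      exact ⟨h.left, (LocalTorsion3.three_nsmul_some_eq_zero_iff_eval_Ψ₃ E h).mp h3P⟩
    · intro s₁ s₂ h
      simp only [Subtype.mk.injEq] at h
      exact Subtype.ext h
  haveI : Finite (WithZero {xy : ℚ_[3] × ℚ_[3] // ∃ h : E.toAffine.Nonsingular xy.1 xy.2,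
      (3 : ℕ) • (Affine.Point.some xy.1 xy.2 h : E.toAffine.Point) = 0}) :=
    inferInstanceAs (Finite (Option _))
  exact Finite.of_equiv _ (Affine.nonsingularPointEquivSubtype (W' := E.toAffine)
    (p := fun Q => (3 : ℕ) • Q = 0) (show (3 : ℕ) • (0 : E.toAffine.Point) = 0 from nsmul_zero 3)).symm

/-- **`#E(ℚ₃)[3] = 3^t` for some `t`** (the row binder `ht` of every W2 END theorem EXISTS on every row):
the `3`-torsion of `E(ℚ₃)` is a finite group killed by `3`. [cite: SilvermanAEC2009, Exercise 3.7(f)] -/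
theorem exists_natCard_threeTorsion_eq_three_pow (W : WeierstrassCurve ℚ) [W.IsElliptic] :
    ∃ t : ℕ, Nat.card {Q : (W.baseChange ℚ_[3]).toAffine.Point // (3 : ℕ) • Q = 0} = 3 ^ t := by
  haveI : Fact (Nat.Prime 3) := ⟨Nat.prime_three⟩
  haveI := finite_threeTorsion_padic (W.baseChange ℚ_[3])
  have e : {Q : (W.baseChange ℚ_[3]).toAffine.Point // (3 : ℕ) • Q = 0} ≃
      AddSubgroup.torsionBy (W.baseChange ℚ_[3]).toAffine.Point (3 : ℕ) :=
    Equiv.subtypeEquivRight fun Q => (AddSubgroup.torsionBy.nsmul_iff (n := 3)).symm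
  haveI : Finite (AddSubgroup.torsionBy (W.baseChange ℚ_[3]).toAffine.Point (3 : ℕ)) :=
    Finite.of_equiv _ e
  obtain ⟨t, ht⟩ := Transport.exists_natCard_eq_pow_of_nsmul_eq_zero (p := 3) (K := 1)
    (X := AddSubgroup.torsionBy (W.baseChange ℚ_[3]).toAffine.Point (3 : ℕ))
    (fun x => by rw [pow_one]; exact AddSubgroup.torsionBy.nsmul x)
  exact ⟨t, by rw [Nat.card_congr e, ht]⟩

/-! ### §6 The registered stub `stub_additiveDefect` of crux 19679, GRANTED PORT₂-SHARED on the defect rows -/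

/-- **`stub_additiveDefect` of the BC3 birth skeleton of crux 19679 (`DeepLowerAtThreeOffKatoStratum`), TYPE
VERBATIM, GRANTED four names + ONE port.**  Names (nothing asserted): the two S24-DEEP ports `hS24d`/`hS24d₂`
(FLAG `S24-DEEP-PORT@3`), GZK `hGZK`, Poitou–Tate `hPT`.  Port `hPort₂` = PORT₂-SHARED ON THE ADDITIVE-DEFECT ROWS:
for every tower-surjective `W` ADDITIVE at `3`, every `t` with `#E(ℚ₃)[3] = 3^t`, every place `v₃ ∣ 3`, every
generator family `η`, every lattice-optimal datum `P` at the conductor whose row carries the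
defect (`3 ∣ c₃ ∨ #E(ℚ₃)[3] ≠ 1 ∨ 3 ∣ c_P`), SOME exponent `e` with
`KatoKuriharaPortThreeAtWith₂TwoExp W t e v₃ η P` (crux 19560's `KatoKuriharaPortThreeShared` shape with the
defect disjunction in place of `3 ∤ c₃ ∧ t = 0 ∧ 3 ∤ c_P`, `∀ t`, `∃ e`; in print `e = v₃(c₃) + v₃(c_P)`, acc6's
`KimAtThreeKolyvaginDefs` docstring; FLAG `K22-Thm3.13-PORT@3`; its `t = 0` instance, with `3^0 = 1`, is the `hPort₂`
of acc6's `KimAtThreeShallowEqDeepOffStratumAdditiveDefect.stub_additiveDefect_of_portTwoExp_of_upperRow` for the twin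
crux 19599 — ONE hypothesis serves both stubs).  Proof: `t` from
`exists_natCard_threeTorsion_eq_three_pow`, a place `v₃` and generators `η` CONSTRUCTED (as in w2-c2's
`KimAtThreeDeepLowerSplitGlue.deepLowerAtThree_of_parts`), then §4.  Composition with the skeleton's
`DeepLowerAtThreeOffKatoStratum_of` is by `exact` on this type. Crux 19679 stays OPEN; nothing booked.
[cite: Kim2025RefinedTNC, Thm 1.1] [cite: Kim2022StructureSelmer, Thm. 1.9 (6), Thm. 3.13]
[cite: Sakamoto2024, Thm. 4.4 (p. 926)] [cite: MazurRubin2004, Thm. 5.2.12] [cite: MilneADT2006, Ch. I, Thm. 4.10] -/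
theorem stubAdditiveDefect_of_portTwoExp
    (hS24d : S24Deep.kolyvaginSystems_freeRankOne_zmod_three_pow_deep)
    (hS24d₂ : S24Deep.kolyvaginSystems_idealOfBasis_eq_fittingIdeal_zmod_three_pow_deep)
    (hGZK : rank_eq_analyticRank_of_analyticRank_le_one)
    (hPT : poitouTate_selmerStructure_duality ℚ)
    (hPort₂ : ∀ (W : WeierstrassCurve ℚ) [W.IsElliptic] [W.IsGloballyMinimal],
      (∀ m : ℕ, W.HasSurjectiveModNGaloisRep (3 ^ m : ℕ)) →
      (haveI : Fact (Nat.Prime 3) := ⟨Nat.prime_three⟩; Addv W 3) →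
      ∀ t : ℕ, Nat.card {Q : (W.baseChange ℚ_[3]).toAffine.Point // (3 : ℕ) • Q = 0} = 3 ^ t →
      ∀ (v₃ : HeightOneSpectrum (𝓞 ℚ)), ((3 : ℕ) : 𝓞 ℚ) ∈ v₃.asIdeal →
      ∀ (η : (q : HeightOneSpectrum (𝓞 ℚ)) → (ZMod (Ideal.absNorm q.asIdeal))ˣ),
        (∀ q, Subgroup.zpowers (η q) = ⊤) →
      ∀ {N : ℕ} [NeZero N] (P : ModularParametrizationData W N), N = W.conductorNorm ℤ →
        (∀ z ∈ P.L.lattice, ∃ w ∈ periodLattice P.f, z = P.c * w) →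
        (3 ∣ (W.baseChange ℚ_[3]).localTamagawaNumber ℤ_[3] ∨
          Nat.card {Q : (W.baseChange ℚ_[3]).toAffine.Point // (3 : ℕ) • Q = 0} ≠ 1 ∨
          (3 : ℤ) ∣ P.maninConstant) →
        ∃ e : ℕ, KatoKuriharaPortThreeAtWith₂TwoExp W t e v₃ η P) :
    ∀ (W₀ : WeierstrassCurve ℚ) [W₀.IsElliptic] [W₀.IsGloballyMinimal],
      (∀ n : ℕ, W₀.HasSurjectiveModNGaloisRep (3 ^ n : ℕ)) → Finite W₀.sha →
      ∀ {N : ℕ} [NeZero N], N = W₀.conductorNorm ℤ →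
      ∀ (D₀ : Literature.NumberTheory.EllipticCurves.ModularForms.ModularParametrizationData W₀ N),
        (∀ z ∈ D₀.L.lattice, ∃ w ∈ Literature.NumberTheory.EllipticCurves.ModularForms.periodLattice D₀.f, z = D₀.c * w) →
        (∀ (W₂ : WeierstrassCurve ℚ) [W₂.IsElliptic]
          (D₂ : Literature.NumberTheory.EllipticCurves.ModularForms.ModularParametrizationData W₂ N),
          D₂.f = D₀.f → D₀.modularDegree ≤ D₂.modularDegree) →
        (∀ r : ℚ, Literature.NumberTheory.EllipticCurves.ratPlusSymbol D₀.f r ≠ 0 →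
          0 ≤ padicValRat 3 (Literature.NumberTheory.EllipticCurves.ratPlusSymbol D₀.f r)) →
        Literature.NumberTheory.EllipticCurves.kuriharaVanishingOrder W₀ 3 D₀.f = 0 →
        (haveI : Fact (Nat.Prime 3) := ⟨Nat.prime_three⟩;
            Literature.NumberTheory.EllipticCurves.Rank1Residual.Addv W₀ 3) →
        (3 ∣ (W₀.baseChange ℚ_[3]).localTamagawaNumber ℤ_[3] ∨
          Nat.card {Q : (W₀.baseChange ℚ_[3]).toAffine.Point // (3 : ℕ) • Q = 0} ≠ 1 ∨
          (3 : ℤ) ∣ D₀.maninConstant) →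
        ∃ d : ℕ, Literature.NumberTheory.EllipticCurves.kuriharaPartialDeepInfty W₀ 3 D₀.f = d ∧
          Literature.NumberTheory.EllipticCurves.kuriharaPartial W₀ 3 D₀.f 0 ≤
            ((padicValNat 3 (Nat.card (AddCommGroup.primaryComponent W₀.sha 3)) + d : ℕ) : ℕ∞) := by
  intro W₀ _ _ htow _ N _ hN D₀ hopt _ _ hord hA hdef
  -- the torsion exponent of the row
  obtain ⟨t, ht⟩ := exists_natCard_threeTorsion_eq_three_pow W₀
  -- the place above 3
  let v₃ : HeightOneSpectrum (𝓞 ℚ) := (Rat.HeightOneSpectrum.primesEquiv (R := 𝓞 ℚ)).symm ⟨3, Nat.prime_three⟩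
  have hgen3 : Rat.HeightOneSpectrum.natGenerator v₃ = 3 :=
    congrArg Subtype.val ((Rat.HeightOneSpectrum.primesEquiv (R := 𝓞 ℚ)).apply_symm_apply ⟨3, Nat.prime_three⟩)
  have hv₃ : ((3 : ℕ) : 𝓞 ℚ) ∈ v₃.asIdeal := by
    have h := Rat.HeightOneSpectrum.natCast_natGenerator_mem v₃
    rwa [hgen3] at h
  -- one generator family η
  have hgen : ∀ q : HeightOneSpectrum (𝓞 ℚ), ∃ η : (ZMod (Ideal.absNorm q.asIdeal))ˣ,
      Subgroup.zpowers η = ⊤ := fun q => by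
    haveI : Fact (Ideal.absNorm q.asIdeal).Prime := ⟨FSComp.prime_absNorm_rat q⟩
    obtain ⟨g, hg⟩ := IsCyclic.exists_generator (α := (ZMod (Ideal.absNorm q.asIdeal))ˣ)
    exact ⟨g, (Subgroup.eq_top_iff' _).mpr hg⟩
  choose η hη using hgen
  -- the port on this row, then §4
  obtain ⟨e, hPort⟩ := hPort₂ W₀ htow hA t ht v₃ hv₃ η hη D₀ hN hopt hdef
  exact deepLower_datum_of_deepPortsTwoExp hS24d hS24d₂ hGZK hPT W₀ t e hA htow ht hN D₀ v₃ hv₃ η hη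
    hPort hord

/-- **§7 (appended): the `t = 0` instance of §6's PORT₂-SHARED-on-defect-rows hypothesis IS acc6's `hPort₂`** of
`KimAtThreeShallowEqDeepOffStratumAdditiveDefectOfPort.stub_additiveDefect_of_portTwoExp` (twin crux 19599, rows
`3 ∣ c₃ ∨ 3 ∣ c_P` at `#E(ℚ₃)[3] = 1`; read `1 = 3^0`, forget the torsion disjunct) — so the route can DISPLAY ONE port
for the whole additive-defect family (19562 / 19599 / 19679). [cite: Kim2022StructureSelmer, Thm. 3.13 (arXiv p. 17)] -/
theorem portTwoExpSharedDefect_torsionFree_of_portTwoExpSharedDefect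
    (hPort₂ : ∀ (W : WeierstrassCurve ℚ) [W.IsElliptic] [W.IsGloballyMinimal],
      (∀ m : ℕ, W.HasSurjectiveModNGaloisRep (3 ^ m : ℕ)) →
      (haveI : Fact (Nat.Prime 3) := ⟨Nat.prime_three⟩; Addv W 3) →
      ∀ t : ℕ, Nat.card {Q : (W.baseChange ℚ_[3]).toAffine.Point // (3 : ℕ) • Q = 0} = 3 ^ t →
      ∀ (v₃ : HeightOneSpectrum (𝓞 ℚ)), ((3 : ℕ) : 𝓞 ℚ) ∈ v₃.asIdeal →
      ∀ (η : (q : HeightOneSpectrum (𝓞 ℚ)) → (ZMod (Ideal.absNorm q.asIdeal))ˣ),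
        (∀ q, Subgroup.zpowers (η q) = ⊤) →
      ∀ {N : ℕ} [NeZero N] (P : ModularParametrizationData W N), N = W.conductorNorm ℤ →
        (∀ z ∈ P.L.lattice, ∃ w ∈ periodLattice P.f, z = P.c * w) →
        (3 ∣ (W.baseChange ℚ_[3]).localTamagawaNumber ℤ_[3] ∨
          Nat.card {Q : (W.baseChange ℚ_[3]).toAffine.Point // (3 : ℕ) • Q = 0} ≠ 1 ∨
          (3 : ℤ) ∣ P.maninConstant) →
        ∃ e : ℕ, KatoKuriharaPortThreeAtWith₂TwoExp W t e v₃ η P) :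
    ∀ (W : WeierstrassCurve ℚ) [W.IsElliptic] [W.IsGloballyMinimal],
      (∀ m : ℕ, W.HasSurjectiveModNGaloisRep (3 ^ m : ℕ)) →
      (haveI : Fact (Nat.Prime 3) := ⟨Nat.prime_three⟩; Addv W 3) →
      Nat.card {Q : (W.baseChange ℚ_[3]).toAffine.Point // (3 : ℕ) • Q = 0} = 1 →
      ∀ (v₃ : HeightOneSpectrum (𝓞 ℚ)), ((3 : ℕ) : 𝓞 ℚ) ∈ v₃.asIdeal →
      ∀ (η : (q : HeightOneSpectrum (𝓞 ℚ)) → (ZMod (Ideal.absNorm q.asIdeal))ˣ),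
        (∀ q, Subgroup.zpowers (η q) = ⊤) →
      ∀ {N : ℕ} [NeZero N] (P : ModularParametrizationData W N), N = W.conductorNorm ℤ →
        (∀ z ∈ P.L.lattice, ∃ w ∈ periodLattice P.f, z = P.c * w) →
        (3 ∣ (W.baseChange ℚ_[3]).localTamagawaNumber ℤ_[3] ∨ (3 : ℤ) ∣ P.maninConstant) →
          ∃ e : ℕ, KatoKuriharaPortThreeAtWith₂TwoExp W 0 e v₃ η P :=
  fun W _ _ htow hA ht0 v₃ hv₃ η hη N _ P hN hopt hdef =>
    hPort₂ W htow hA 0 (by rw [pow_zero]; exact ht0) v₃ hv₃ η hη P hN hopt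
      (hdef.elim Or.inl fun h => Or.inr (Or.inr h))

end Summit.BirchSwinnertonDyer.BirchSwinnertonDyer.Theorems.KimAtThreeDeepLowerOffStratumAdditiveDefectPortTwoExp

end
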